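import Summits.CriticalPhenomena.PercolationContinuityZ3.Theorems.PercNearOneGluingNoHeavyQuantTLBBelowTargets
import Summits.CriticalPhenomena.PercolationContinuityZ3.Theorems.PercNearOneGluingNoHeavyQuantPhantomRowsSharpLe
import HarnessLib

/-!
# QUANT lane: EVERY ROW OF THE GATED HEAVY NODE from a FREE-TARGET (targets ≤ means) Theorem A — the heavy node's binder, expanded

builds on p205010 (kernel theorem, internal audit signed; external expert review pending)

Support file (`--supports stmt-CriticalPhenomena-4575`), QUANT lane seat prim-quant-arm-1 (gen 42); memo
`run/shared/lean/prim/quant/prim-quant-arm-1-g42/PHANTOM-ROWS-G42.md` §5, `…/lean/LANDING-ORDER.md`.  Imports only COMMITTED modules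
(`…QuantTLBBelowTargets`, prim-quant-arm-3 g165; `…QuantPhantomRowsSharpLe`, arm-1 g42); no definitions, no sorries, standard axioms.
The free-target Theorem A enters as the HYPOTHESIS `hF` = the literal conclusion shape of `LawDec.twoLayer_lconv_free_of_meanTied`
(`…QuantTwoLayerFreeTarget`, arm-1 g42, which derives it from the mean-tied Theorem A of prim-quant-arm-2 g38 by stochastic lowering).

* `LawDec.thmA_weak_instance_of_free` — the weak instance consumed by `gateConv_row_aboveTarget_of_thmA_le`, from `hF` (normalize the
  de-phantomed factor, ungate the other factor's rows).
* `LawDec.gateConv_rows_heavy_of_freeThmA` — every row for non-degenerate factors: `k < q·min Tᵢ` by `gateConv_row_belowTargets`,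
  `k ≥ q·Tᵢ` by the ♯ removal with the roles of the factors as needed (`lconv` symmetric).
* `LawDec.gateConv_tlbRows_of_freeThmA` — the FULL binder of `LawDec.TLBGateConvClosedHeavy` (lead g37, ⧗ `…QuantTLBClosureHeavy`) with
  `TLB` unfolded; factors of mean `0` are `δ₀` and the convolution is the other factor.  The by-name corollaries
  `tlbGateConvClosedHeavy_holds` / `farTreeRowHeavy_holds` are then the terms
  `gateConv_tlbRows_of_freeThmA (fun y … => twoLayer_lconv_free_of_meanTied ‹_› ‹_› (twoLayer_lconv_of_half_le y …))` once
  `…QuantTwoLayerFreeTarget`, `…QuantTwoLayerHalf` (⧗ p375979) and `…QuantTLBClosureHeavy` (⧗ p376241) are in the tree.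

Combined scratch of the whole chain: `quant/prim-quant-arm-1-g42/lean/Scratch_All_combined.lean` (farm rc 0, std axioms).
[this work]; Theorem A: prim-quant-arm-2 g38; below-target rows: prim-quant-arm-3 g165.  The rows served belong to the gluing programme
of [cite: KozmaNitzan2024, Conjecture 3 (p. 15)].
-/

noncomputable section

namespace Summit.CriticalPhenomena.PercolationContinuityZ3.Theorems

namespace Quant

open Finset

namespace LawDec


/-- `lconv` is symmetric (as in `…QuantGatedConvSplit`). [this work] -/
private theorem hnr_lconv_comm (M₁ M₂ : ℕ) (μ₁ μ₂ : ℕ → ℝ) : lconv M₁ M₂ μ₁ μ₂ = lconv M₂ M₁ μ₂ μ₁ := by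
  funext h
  simp only [lconv]
  rw [Finset.sum_comm]
  refine Finset.sum_congr rfl fun k _ => Finset.sum_congr rfl fun i _ => ?_
  by_cases hik : i + k = h
  · rw [if_pos hik, if_pos (by omega), mul_comm]
  · rw [if_neg hik, if_neg (by omega)]

/-- `lconv` is homogeneous in the first factor. [this work] -/
private theorem hnr_lconv_smul_left (M₁ M₂ : ℕ) (μ₁ μ₂ : ℕ → ℝ) (r : ℝ) (h : ℕ) :
    lconv M₁ M₂ (fun a => r * μ₁ a) μ₂ h = r * lconv M₁ M₂ μ₁ μ₂ h := by
  simp only [lconv, Finset.mul_sum]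
  refine Finset.sum_congr rfl fun i _ => Finset.sum_congr rfl fun j _ => ?_
  split_ifs <;> ring

/-- **gated rows imply ungated rows** (drop the phantom atom: `u(1−q) ≥ 0`). [this work] -/
private theorem hnr_rows_of_gateRows {y q T : ℝ} {M : ℕ} {μ : ℕ → ℝ} (hy0 : 0 < y) (hy1 : y < 1) (hq0 : 0 < q) (hq1 : q ≤ 1)
    (hrow : ∀ c : ℕ, 2 * (c : ℝ) < q * T →
      y / (1 - y) * ∑ h ∈ Finset.range (c + 1), gate μ q h
        ≤ ∑ h ∈ Finset.range (M + 1), (if q * T - c ≤ (h : ℝ) then gate μ q h else 0))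
    (c : ℕ) (hc : 2 * (c : ℝ) < q * T) :
    y / (1 - y) * ∑ h ∈ Finset.range (c + 1), μ h ≤ ∑ h ∈ Finset.range (M + 1), (if q * T - c ≤ (h : ℝ) then μ h else 0) := by
  have h1y : 0 < 1 - y := by linarith
  have hu0 : 0 < y / (1 - y) := div_pos hy0 h1y
  have hcr : (0 : ℝ) ≤ c := Nat.cast_nonneg c
  have hg := hrow c hc
  have hlow : ∑ h ∈ Finset.range (c + 1), gate μ q h = (1 - q) + q * ∑ h ∈ Finset.range (c + 1), μ h := by
    simp only [gate]
    rw [Finset.sum_add_distrib, ← Finset.mul_sum, Finset.sum_ite_eq' (Finset.range (c + 1)) 0,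
      if_pos (Finset.mem_range.2 (Nat.succ_pos c))]
    ring
  have hhigh : ∑ h ∈ Finset.range (M + 1), (if q * T - c ≤ (h : ℝ) then gate μ q h else 0)
      = q * ∑ h ∈ Finset.range (M + 1), (if q * T - c ≤ (h : ℝ) then μ h else 0) := by
    rw [Finset.mul_sum]
    refine Finset.sum_congr rfl fun h _ => ?_
    by_cases hth : q * T - c ≤ (h : ℝ)
    · rw [if_pos hth, if_pos hth]
      have hne : h ≠ 0 := by rintro rfl; rw [Nat.cast_zero] at hth; linarith
      simp only [gate, if_neg hne, add_zero]
    · rw [if_neg hth, if_neg hth, mul_zero]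
  rw [hlow, hhigh] at hg
  have h2 : q * (y / (1 - y) * ∑ h ∈ Finset.range (c + 1), μ h)
      ≤ q * ∑ h ∈ Finset.range (M + 1), (if q * T - c ≤ (h : ℝ) then μ h else 0) := by
    nlinarith [mul_nonneg hu0.le (show (0:ℝ) ≤ 1 - q by linarith)]
  exact le_of_mul_le_mul_left h2 hq0

/-- **THE WEAK FREE-TARGET INSTANCE** consumed by `gateConv_row_aboveTarget_of_thmA_le`, from the mean-tied Theorem A `hA`:
for `ν₁ ≥ 0` on `{0..M₁}` of positive mass with `qT₁·mass ≤ first moment` and the ungated rows at `qT₁`, and a probability law `μ₂`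
on `{0..M₂}` with mean `T₂ > 0` whose gated version has the rows at `qT₂`, row `k` of `lconv ν₁ μ₂` at threshold `q(T₁+T₂) − k`
(`2k < q(T₁+T₂)`).  Proof: normalize `ν₁`, ungate `μ₂`'s rows, `twoLayer_lconv_free_of_meanTied`, rescale. [this work] -/
theorem thmA_weak_instance_of_free {y q T₁ T₂ : ℝ} (hy : 1 / 2 ≤ y) (hy1 : y < 1) (hq0 : 0 < q) (hq1 : q ≤ 1)
    (hF : ∀ (M₁ M₂ : ℕ) (ν₁ ν₂ : ℕ → ℝ) (τ₁ τ₂ : ℝ),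
      (∀ h, 0 ≤ ν₁ h) → (∑ h ∈ Finset.range (M₁ + 1), ν₁ h = 1) →
      (∀ h, 0 ≤ ν₂ h) → (∑ h ∈ Finset.range (M₂ + 1), ν₂ h = 1) →
      0 < τ₁ → τ₁ ≤ ∑ h ∈ Finset.range (M₁ + 1), (h : ℝ) * ν₁ h →
      0 < τ₂ → τ₂ ≤ ∑ h ∈ Finset.range (M₂ + 1), (h : ℝ) * ν₂ h →
      (∀ c : ℕ, 2 * (c : ℝ) < τ₁ →
        y / (1 - y) * ∑ h ∈ Finset.range (c + 1), ν₁ h ≤ ∑ h ∈ Finset.range (M₁ + 1), (if τ₁ - c ≤ (h : ℝ) then ν₁ h else 0)) →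
      (∀ c : ℕ, 2 * (c : ℝ) < τ₂ →
        y / (1 - y) * ∑ h ∈ Finset.range (c + 1), ν₂ h ≤ ∑ h ∈ Finset.range (M₂ + 1), (if τ₂ - c ≤ (h : ℝ) then ν₂ h else 0)) →
      ∀ k : ℕ, 2 * (k : ℝ) < τ₁ + τ₂ →
        y / (1 - y) * ∑ h ∈ Finset.range (k + 1), lconv M₁ M₂ ν₁ ν₂ h
          ≤ ∑ h ∈ Finset.range (M₁ + M₂ + 1), (if τ₁ + τ₂ - k ≤ (h : ℝ) then lconv M₁ M₂ ν₁ ν₂ h else 0))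
    {M₁ M₂ : ℕ} {μ₂ : ℕ → ℝ} (h20 : ∀ h, 0 ≤ μ₂ h) (h21 : ∑ h ∈ Finset.range (M₂ + 1), μ₂ h = 1)
    (hT2 : ∑ h ∈ Finset.range (M₂ + 1), (h : ℝ) * μ₂ h = T₂) (hT2p : 0 < T₂) (hT1p : 0 < q * T₁)
    (hrow2 : ∀ c : ℕ, 2 * (c : ℝ) < q * T₂ →
      y / (1 - y) * ∑ h ∈ Finset.range (c + 1), gate μ₂ q h
        ≤ ∑ h ∈ Finset.range (M₂ + 1), (if q * T₂ - c ≤ (h : ℝ) then gate μ₂ q h else 0))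
    {k : ℕ} (h2k : 2 * (k : ℝ) < q * (T₁ + T₂))
    (ν₁ : ℕ → ℝ) (hν0 : ∀ h, 0 ≤ ν₁ h) (_hνM : ∀ h, M₁ < h → ν₁ h = 0)
    (hνpos : 0 < ∑ h ∈ Finset.range (M₁ + 1), ν₁ h)
    (hνmom : q * T₁ * ∑ h ∈ Finset.range (M₁ + 1), ν₁ h ≤ ∑ h ∈ Finset.range (M₁ + 1), (h : ℝ) * ν₁ h)
    (hνrows : ∀ c : ℕ, 2 * (c : ℝ) < q * T₁ →
      y / (1 - y) * ∑ h ∈ Finset.range (c + 1), ν₁ h ≤ ∑ h ∈ Finset.range (M₁ + 1), (if q * T₁ - c ≤ (h : ℝ) then ν₁ h else 0)) :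
    y / (1 - y) * ∑ h ∈ Finset.range (k + 1), lconv M₁ M₂ ν₁ μ₂ h
      ≤ ∑ h ∈ Finset.range (M₁ + M₂ + 1), (if q * (T₁ + T₂) - k ≤ (h : ℝ) then lconv M₁ M₂ ν₁ μ₂ h else 0) := by
  have hy0 : 0 < y := by linarith
  set m : ℝ := ∑ h ∈ Finset.range (M₁ + 1), ν₁ h with hm
  set ν : ℕ → ℝ := fun a => m⁻¹ * ν₁ a with hν
  have hm0 : 0 < m := hνpos
  have g0 : ∀ h, 0 ≤ ν h := fun h => mul_nonneg (inv_nonneg.mpr hm0.le) (hν0 h)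
  have g1 : ∑ h ∈ Finset.range (M₁ + 1), ν h = 1 := by
    rw [hν, ← Finset.mul_sum, ← hm, inv_mul_cancel₀ (ne_of_gt hm0)]
  have gmean : q * T₁ ≤ ∑ h ∈ Finset.range (M₁ + 1), (h : ℝ) * ν h := by
    have e : ∑ h ∈ Finset.range (M₁ + 1), (h : ℝ) * ν h = m⁻¹ * ∑ h ∈ Finset.range (M₁ + 1), (h : ℝ) * ν₁ h := by
      rw [hν, Finset.mul_sum]
      exact Finset.sum_congr rfl fun h _ => by ring
    rw [e, ← div_eq_inv_mul, le_div_iff₀ hm0]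
    linarith
  have grows : ∀ c : ℕ, 2 * (c : ℝ) < q * T₁ →
      y / (1 - y) * ∑ h ∈ Finset.range (c + 1), ν h ≤ ∑ h ∈ Finset.range (M₁ + 1), (if q * T₁ - c ≤ (h : ℝ) then ν h else 0) := by
    intro c hc
    have e1 : ∑ h ∈ Finset.range (c + 1), ν h = m⁻¹ * ∑ h ∈ Finset.range (c + 1), ν₁ h := by rw [hν, Finset.mul_sum]
    have e2 : ∑ h ∈ Finset.range (M₁ + 1), (if q * T₁ - c ≤ (h : ℝ) then ν h else 0)
        = m⁻¹ * ∑ h ∈ Finset.range (M₁ + 1), (if q * T₁ - c ≤ (h : ℝ) then ν₁ h else 0) := by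
      rw [hν, Finset.mul_sum]
      exact Finset.sum_congr rfl fun h _ => by split_ifs <;> ring
    rw [e1, e2, ← mul_assoc, mul_comm (y / (1 - y)), mul_assoc]
    exact mul_le_mul_of_nonneg_left (hνrows c hc) (inv_nonneg.mpr hm0.le)
  -- ungated rows of `μ₂` at `qT₂`
  have rows2 : ∀ c : ℕ, 2 * (c : ℝ) < q * T₂ →
      y / (1 - y) * ∑ h ∈ Finset.range (c + 1), μ₂ h ≤ ∑ h ∈ Finset.range (M₂ + 1), (if q * T₂ - c ≤ (h : ℝ) then μ₂ h else 0) :=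
    fun c hc => hnr_rows_of_gateRows hy0 hy1 hq0 hq1 hrow2 c hc
  have hτ2m : q * T₂ ≤ ∑ h ∈ Finset.range (M₂ + 1), (h : ℝ) * μ₂ h := by rw [hT2]; nlinarith
  have hfree := hF M₁ M₂ ν μ₂ (q * T₁) (q * T₂) g0 g1 h20 h21 hT1p gmean (by nlinarith) hτ2m grows rows2 k (by linarith)
  -- rescale: `lconv ν μ₂ = m⁻¹ · lconv ν₁ μ₂`
  have e : ∀ h, lconv M₁ M₂ ν μ₂ h = m⁻¹ * lconv M₁ M₂ ν₁ μ₂ h := fun h => hnr_lconv_smul_left M₁ M₂ ν₁ μ₂ m⁻¹ h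
  simp only [e] at hfree
  rw [← Finset.mul_sum] at hfree
  have e2 : ∑ h ∈ Finset.range (M₁ + M₂ + 1), (if q * T₁ + q * T₂ - k ≤ (h : ℝ) then m⁻¹ * lconv M₁ M₂ ν₁ μ₂ h else 0)
      = m⁻¹ * ∑ h ∈ Finset.range (M₁ + M₂ + 1), (if q * (T₁ + T₂) - k ≤ (h : ℝ) then lconv M₁ M₂ ν₁ μ₂ h else 0) := by
    rw [Finset.mul_sum]
    refine Finset.sum_congr rfl fun h _ => ?_
    rw [show q * T₁ + q * T₂ = q * (T₁ + T₂) by ring]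
    split_ifs <;> ring
  rw [e2, ← mul_assoc, mul_comm (y / (1 - y)), mul_assoc] at hfree
  exact le_of_mul_le_mul_left hfree (inv_pos.mpr hm0)

/-- **EVERY ROW OF THE HEAVY NODE, from the mean-tied Theorem A `hA`.**  See the file header. [this work] -/
theorem gateConv_rows_heavy_of_freeThmA {y q T₁ T₂ : ℝ} (hy : 1 / 2 ≤ y) (hy1 : y < 1) (hq0 : 0 < q) (hq1 : q ≤ 1)
    (hF : ∀ (M₁ M₂ : ℕ) (ν₁ ν₂ : ℕ → ℝ) (τ₁ τ₂ : ℝ),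
      (∀ h, 0 ≤ ν₁ h) → (∑ h ∈ Finset.range (M₁ + 1), ν₁ h = 1) →
      (∀ h, 0 ≤ ν₂ h) → (∑ h ∈ Finset.range (M₂ + 1), ν₂ h = 1) →
      0 < τ₁ → τ₁ ≤ ∑ h ∈ Finset.range (M₁ + 1), (h : ℝ) * ν₁ h →
      0 < τ₂ → τ₂ ≤ ∑ h ∈ Finset.range (M₂ + 1), (h : ℝ) * ν₂ h →
      (∀ c : ℕ, 2 * (c : ℝ) < τ₁ →
        y / (1 - y) * ∑ h ∈ Finset.range (c + 1), ν₁ h ≤ ∑ h ∈ Finset.range (M₁ + 1), (if τ₁ - c ≤ (h : ℝ) then ν₁ h else 0)) →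
      (∀ c : ℕ, 2 * (c : ℝ) < τ₂ →
        y / (1 - y) * ∑ h ∈ Finset.range (c + 1), ν₂ h ≤ ∑ h ∈ Finset.range (M₂ + 1), (if τ₂ - c ≤ (h : ℝ) then ν₂ h else 0)) →
      ∀ k : ℕ, 2 * (k : ℝ) < τ₁ + τ₂ →
        y / (1 - y) * ∑ h ∈ Finset.range (k + 1), lconv M₁ M₂ ν₁ ν₂ h
          ≤ ∑ h ∈ Finset.range (M₁ + M₂ + 1), (if τ₁ + τ₂ - k ≤ (h : ℝ) then lconv M₁ M₂ ν₁ ν₂ h else 0))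
    {M₁ M₂ : ℕ} {μ₁ μ₂ : ℕ → ℝ}
    (h10 : ∀ h, 0 ≤ μ₁ h) (h1M : ∀ h, M₁ < h → μ₁ h = 0) (h11 : ∑ h ∈ Finset.range (M₁ + 1), μ₁ h = 1)
    (hT1 : ∑ h ∈ Finset.range (M₁ + 1), (h : ℝ) * μ₁ h = T₁) (hT1p : 0 < T₁) (hTA1 : y * (M₁ : ℝ) ≤ q * T₁)
    (h20 : ∀ h, 0 ≤ μ₂ h) (h2M : ∀ h, M₂ < h → μ₂ h = 0) (h21 : ∑ h ∈ Finset.range (M₂ + 1), μ₂ h = 1)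
    (hT2 : ∑ h ∈ Finset.range (M₂ + 1), (h : ℝ) * μ₂ h = T₂) (hT2p : 0 < T₂) (hTA2 : y * (M₂ : ℝ) ≤ q * T₂)
    (hrow1 : ∀ c : ℕ, 2 * (c : ℝ) < q * T₁ →
      y / (1 - y) * ∑ h ∈ Finset.range (c + 1), gate μ₁ q h
        ≤ ∑ h ∈ Finset.range (M₁ + 1), (if q * T₁ - c ≤ (h : ℝ) then gate μ₁ q h else 0))
    (hrow2 : ∀ c : ℕ, 2 * (c : ℝ) < q * T₂ →
      y / (1 - y) * ∑ h ∈ Finset.range (c + 1), gate μ₂ q h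
        ≤ ∑ h ∈ Finset.range (M₂ + 1), (if q * T₂ - c ≤ (h : ℝ) then gate μ₂ q h else 0))
    (d : ℕ) (h2d : 2 * (d : ℝ) < q * (T₁ + T₂)) :
    y / (1 - y) * ∑ h ∈ Finset.range (d + 1), gate (lconv M₁ M₂ μ₁ μ₂) q h
      ≤ ∑ h ∈ Finset.range (M₁ + M₂ + 1),
          (if q * (T₁ + T₂) - d ≤ (h : ℝ) then gate (lconv M₁ M₂ μ₁ μ₂) q h else 0) := by
  have hy0 : 0 < y := by linarith
  have hyq : y ≤ q := by
    -- `y·M₁ ≤ q·T₁ ≤ q·M₁` and `M₁ > 0` (since `T₁ > 0`)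
    have hT1M : T₁ ≤ M₁ := by
      rw [← hT1]
      calc ∑ h ∈ Finset.range (M₁ + 1), (h : ℝ) * μ₁ h ≤ ∑ h ∈ Finset.range (M₁ + 1), (M₁ : ℝ) * μ₁ h := by
            refine Finset.sum_le_sum fun h hh => ?_
            rw [Finset.mem_range] at hh
            have : (h : ℝ) ≤ M₁ := by exact_mod_cast Nat.lt_succ_iff.mp hh
            exact mul_le_mul_of_nonneg_right this (h10 h)
        _ = M₁ := by rw [← Finset.mul_sum, h11, mul_one]
    have hM1p : (0 : ℝ) < M₁ := lt_of_lt_of_le hT1p hT1M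
    nlinarith
  by_cases hlow : (d : ℝ) < q * T₁ ∧ (d : ℝ) < q * T₂
  · exact gateConv_row_belowTargets hy0 hy1 hyq hq1 h10 h11 hT1 h20 h21 hT2 hTA1 hTA2 hlow.1 hlow.2 h2d
  · rw [not_and_or, not_lt, not_lt] at hlow
    rcases hlow with hd1 | hd2
    · -- `q·T₁ ≤ d`: ♯ with the roles of the factors swapped
      have hqT2 : 0 < q * T₂ := mul_pos hq0 hT2p
      have h2d' : 2 * (d : ℝ) < q * (T₂ + T₁) := by rw [add_comm]; exact h2d
      have key := gateConv_row_aboveTarget_of_thmA_le (M₂ := M₁) (μ₂ := μ₁) hy0 hy1 hq0 hq1 h20 h2M h21 hT2 hTA2 h11 hqT2 hrow2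
        hT1p.le hd1 h2d'
        (fun ν hν0 hνM hνpos hνmom hνrows =>
          thmA_weak_instance_of_free hy hy1 hq0 hq1 hF h10 h11 hT1 hT1p hqT2 hrow1 h2d' ν hν0 hνM hνpos hνmom hνrows)
      rw [hnr_lconv_comm M₁ M₂ μ₁ μ₂, Nat.add_comm M₁ M₂, add_comm T₁ T₂]
      exact key
    · -- `q·T₂ ≤ d`
      have hqT1 : 0 < q * T₁ := mul_pos hq0 hT1p
      exact gateConv_row_aboveTarget_of_thmA_le hy0 hy1 hq0 hq1 h10 h1M h11 hT1 hTA1 h21 hqT1 hrow1 hT2p.le hd2 h2d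
        (fun ν hν0 hνM hνpos hνmom hνrows =>
          thmA_weak_instance_of_free hy hy1 hq0 hq1 hF h20 h21 hT2 hT2p hqT1 hrow2 h2d ν hν0 hνM hνpos hνmom hνrows)



/-- a nonnegative probability law with mean `0` is `δ₀` on `{0..M}`. [this work] -/
private theorem hn_eq_delta_of_mean_zero {M : ℕ} {μ : ℕ → ℝ} (hμ : ∀ h, 0 ≤ μ h) (hμ1 : ∑ h ∈ Finset.range (M + 1), μ h = 1)
    (hT : ∑ h ∈ Finset.range (M + 1), (h : ℝ) * μ h = 0) :
    ∀ h ∈ Finset.range (M + 1), μ h = if h = 0 then 1 else 0 := by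
  have hz : ∀ h ∈ Finset.range (M + 1), (h : ℝ) * μ h = 0 :=
    (Finset.sum_eq_zero_iff_of_nonneg fun h _ => mul_nonneg (Nat.cast_nonneg h) (hμ h)).mp hT
  have hpos : ∀ h ∈ Finset.range (M + 1), h ≠ 0 → μ h = 0 := by
    intro h hh hne
    have := hz h hh
    have hhr : (0 : ℝ) < h := by exact_mod_cast Nat.pos_of_ne_zero hne
    rcases mul_eq_zero.mp this with h1 | h1
    · linarith
    · exact h1
  intro h hh
  split_ifs with h0
  · subst h0
    have e : ∑ h ∈ Finset.range (M + 1), μ h = μ 0 := by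
      rw [Finset.sum_eq_single 0 (fun h hh hne => hpos h hh hne) (fun hn => (hn (Finset.mem_range.2 (Nat.succ_pos M))).elim)]
    rw [← e, hμ1]
  · exact hpos h hh h0

/-- the convolution with `δ₀` (a first factor of mean `0`) is the second factor, cut off at `M₂`. [this work] -/
private theorem hn_lconv_delta {M₁ M₂ : ℕ} {μ₁ μ₂ : ℕ → ℝ} (hδ : ∀ h ∈ Finset.range (M₁ + 1), μ₁ h = if h = 0 then 1 else 0) (h : ℕ) :
    lconv M₁ M₂ μ₁ μ₂ h = if h ≤ M₂ then μ₂ h else 0 := by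
  simp only [lconv]
  rw [Finset.sum_eq_single 0]
  · rw [hδ 0 (Finset.mem_range.2 (Nat.succ_pos M₁)), if_pos rfl]
    simp only [zero_add, one_mul]
    split_ifs with hM
    · rw [Finset.sum_ite_eq' (Finset.range (M₂ + 1)) h, if_pos (Finset.mem_range.2 (by omega))]
    · exact Finset.sum_eq_zero fun k hk => by
        rw [Finset.mem_range] at hk
        rw [if_neg (by omega)]
  · intro i hi hne
    rw [hδ i hi, if_neg hne]
    exact Finset.sum_eq_zero fun k _ => by split_ifs <;> simp
  · intro hn; exact (hn (Finset.mem_range.2 (Nat.succ_pos M₁))).elim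

/-- the degenerate row: if the first factor is `δ₀` the gated convolution has the gated rows of the second factor. [this work] -/
private theorem hn_row_of_delta {y q τ : ℝ} {M₁ M₂ d : ℕ} {μ₁ μ₂ : ℕ → ℝ}
    (hδ : ∀ h ∈ Finset.range (M₁ + 1), μ₁ h = if h = 0 then 1 else 0) (hd : 2 * (d : ℝ) < τ) (hτM : τ ≤ (M₂ : ℝ) + 1)
    (hrow : y / (1 - y) * ∑ h ∈ Finset.range (d + 1), gate μ₂ q h
        ≤ ∑ h ∈ Finset.range (M₂ + 1), (if τ - d ≤ (h : ℝ) then gate μ₂ q h else 0)) :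
    y / (1 - y) * ∑ h ∈ Finset.range (d + 1), gate (lconv M₁ M₂ μ₁ μ₂) q h
      ≤ ∑ h ∈ Finset.range (M₁ + M₂ + 1), (if τ - d ≤ (h : ℝ) then gate (lconv M₁ M₂ μ₁ μ₂) q h else 0) := by
  have hdr : (0 : ℝ) ≤ d := Nat.cast_nonneg d
  have hdM : d ≤ M₂ := by
    have : (d : ℝ) < (M₂ : ℝ) + 1 := by linarith
    have : d < M₂ + 1 := by exact_mod_cast this
    omega
  have hg : ∀ h, gate (lconv M₁ M₂ μ₁ μ₂) q h = if h ≤ M₂ then gate μ₂ q h else 0 := by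
    intro h
    simp only [gate, hn_lconv_delta hδ h]
    split_ifs with h1 h2 <;> first | rfl | omega | simp
  have e1 : ∑ h ∈ Finset.range (d + 1), gate (lconv M₁ M₂ μ₁ μ₂) q h = ∑ h ∈ Finset.range (d + 1), gate μ₂ q h :=
    Finset.sum_congr rfl fun h hh => by
      rw [Finset.mem_range] at hh
      rw [hg h, if_pos (by omega)]
  have e2 : ∑ h ∈ Finset.range (M₁ + M₂ + 1), (if τ - d ≤ (h : ℝ) then gate (lconv M₁ M₂ μ₁ μ₂) q h else 0)
      = ∑ h ∈ Finset.range (M₂ + 1), (if τ - d ≤ (h : ℝ) then gate μ₂ q h else 0) := by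
    have hsub : Finset.range (M₂ + 1) ⊆ Finset.range (M₁ + M₂ + 1) := Finset.range_mono (by omega)
    set F : ℕ → ℝ := fun h => if τ - d ≤ (h : ℝ) then (if h ≤ M₂ then gate μ₂ q h else 0) else 0 with hF
    have s1 : ∑ h ∈ Finset.range (M₁ + M₂ + 1), (if τ - d ≤ (h : ℝ) then gate (lconv M₁ M₂ μ₁ μ₂) q h else 0)
        = ∑ h ∈ Finset.range (M₁ + M₂ + 1), F h :=
      Finset.sum_congr rfl fun h _ => by rw [hF, hg h]
    have s2 : ∑ h ∈ Finset.range (M₂ + 1), F h = ∑ h ∈ Finset.range (M₁ + M₂ + 1), F h := by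
      refine Finset.sum_subset hsub fun h _ hn => ?_
      rw [Finset.mem_range] at hn
      simp only [hF, if_neg (show ¬ h ≤ M₂ by omega), ite_self]
    have s3 : ∑ h ∈ Finset.range (M₂ + 1), F h = ∑ h ∈ Finset.range (M₂ + 1), (if τ - d ≤ (h : ℝ) then gate μ₂ q h else 0) :=
      Finset.sum_congr rfl fun h hh => by
        rw [Finset.mem_range] at hh
        simp only [hF, if_pos (show h ≤ M₂ by omega)]
    rw [s1, ← s2, s3]
  rw [e1, e2]
  exact hrow

/-- **THE HEAVY NODE'S ROWS FROM THE MEAN-TIED THEOREM A (expanded binder).**  The literal statement of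
`LawDec.twoLayer_lconv_of_half_le` (prim-quant-arm-2 g38) implies every two-layer row of the gated convolution in the binder of
`LawDec.TLBGateConvClosedHeavy`. [this work] -/
theorem gateConv_tlbRows_of_freeThmA
    (hF : ∀ (y : ℝ) (M₁ M₂ : ℕ) (ν₁ ν₂ : ℕ → ℝ) (τ₁ τ₂ : ℝ), 1 / 2 ≤ y → y < 1 →
      (∀ h, 0 ≤ ν₁ h) → (∑ h ∈ Finset.range (M₁ + 1), ν₁ h = 1) →
      (∀ h, 0 ≤ ν₂ h) → (∑ h ∈ Finset.range (M₂ + 1), ν₂ h = 1) →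
      0 < τ₁ → τ₁ ≤ ∑ h ∈ Finset.range (M₁ + 1), (h : ℝ) * ν₁ h →
      0 < τ₂ → τ₂ ≤ ∑ h ∈ Finset.range (M₂ + 1), (h : ℝ) * ν₂ h →
      (∀ c : ℕ, 2 * (c : ℝ) < τ₁ →
        y / (1 - y) * ∑ h ∈ Finset.range (c + 1), ν₁ h ≤ ∑ h ∈ Finset.range (M₁ + 1), (if τ₁ - c ≤ (h : ℝ) then ν₁ h else 0)) →
      (∀ c : ℕ, 2 * (c : ℝ) < τ₂ →
        y / (1 - y) * ∑ h ∈ Finset.range (c + 1), ν₂ h ≤ ∑ h ∈ Finset.range (M₂ + 1), (if τ₂ - c ≤ (h : ℝ) then ν₂ h else 0)) →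
      ∀ k : ℕ, 2 * (k : ℝ) < τ₁ + τ₂ →
        y / (1 - y) * ∑ h ∈ Finset.range (k + 1), lconv M₁ M₂ ν₁ ν₂ h
          ≤ ∑ h ∈ Finset.range (M₁ + M₂ + 1), (if τ₁ + τ₂ - k ≤ (h : ℝ) then lconv M₁ M₂ ν₁ ν₂ h else 0)) :
    ∀ (y q : ℝ) (M₁ M₂ : ℕ) (μ₁ μ₂ : ℕ → ℝ),
    1 / 2 ≤ y → y < 1 → 0 < q → q ≤ 1 →
    (∀ h, 0 ≤ μ₁ h) → (∀ h, M₁ < h → μ₁ h = 0) → (∑ h ∈ Finset.range (M₁ + 1), μ₁ h = 1) →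
    y * (M₁ : ℝ) ≤ q * ∑ h ∈ Finset.range (M₁ + 1), (h : ℝ) * μ₁ h →
    (∀ h, 0 ≤ μ₂ h) → (∀ h, M₂ < h → μ₂ h = 0) → (∑ h ∈ Finset.range (M₂ + 1), μ₂ h = 1) →
    y * (M₂ : ℝ) ≤ q * ∑ h ∈ Finset.range (M₂ + 1), (h : ℝ) * μ₂ h →
    (∀ d : ℕ, 2 * (d : ℝ) < q * ∑ h ∈ Finset.range (M₁ + 1), (h : ℝ) * μ₁ h →
      y / (1 - y) * ∑ h ∈ Finset.range (d + 1), gate μ₁ q h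
        ≤ ∑ h ∈ Finset.range (M₁ + 1),
          (if q * (∑ k ∈ Finset.range (M₁ + 1), (k : ℝ) * μ₁ k) - d ≤ (h : ℝ) then gate μ₁ q h else 0)) →
    (∀ d : ℕ, 2 * (d : ℝ) < q * ∑ h ∈ Finset.range (M₂ + 1), (h : ℝ) * μ₂ h →
      y / (1 - y) * ∑ h ∈ Finset.range (d + 1), gate μ₂ q h
        ≤ ∑ h ∈ Finset.range (M₂ + 1),
          (if q * (∑ k ∈ Finset.range (M₂ + 1), (k : ℝ) * μ₂ k) - d ≤ (h : ℝ) then gate μ₂ q h else 0)) →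
    ∀ d : ℕ, 2 * (d : ℝ) < q * ((∑ h ∈ Finset.range (M₁ + 1), (h : ℝ) * μ₁ h) + ∑ h ∈ Finset.range (M₂ + 1), (h : ℝ) * μ₂ h) →
      y / (1 - y) * ∑ h ∈ Finset.range (d + 1), gate (lconv M₁ M₂ μ₁ μ₂) q h
        ≤ ∑ h ∈ Finset.range (M₁ + M₂ + 1),
          (if q * ((∑ k ∈ Finset.range (M₁ + 1), (k : ℝ) * μ₁ k) + ∑ k ∈ Finset.range (M₂ + 1), (k : ℝ) * μ₂ k) - d ≤ (h : ℝ)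
            then gate (lconv M₁ M₂ μ₁ μ₂) q h else 0) := by
  intro y q M₁ M₂ μ₁ μ₂ hy hy1 hq0 hq1 n1 z1 s1 t1 n2 z2 s2 t2 c1 c2 d hd
  set T₁ : ℝ := ∑ h ∈ Finset.range (M₁ + 1), (h : ℝ) * μ₁ h with hT₁
  set T₂ : ℝ := ∑ h ∈ Finset.range (M₂ + 1), (h : ℝ) * μ₂ h with hT₂
  have hy0 : 0 < y := by linarith
  have hT10 : 0 ≤ T₁ := Finset.sum_nonneg fun h _ => mul_nonneg (Nat.cast_nonneg h) (n1 h)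
  have hT20 : 0 ≤ T₂ := Finset.sum_nonneg fun h _ => mul_nonneg (Nat.cast_nonneg h) (n2 h)
  have hmeanle : ∀ (M : ℕ) (μ : ℕ → ℝ), (∀ h, 0 ≤ μ h) → ∑ h ∈ Finset.range (M + 1), μ h = 1 →
      ∑ h ∈ Finset.range (M + 1), (h : ℝ) * μ h ≤ M := by
    intro M μ hμ hμ1
    calc ∑ h ∈ Finset.range (M + 1), (h : ℝ) * μ h ≤ ∑ h ∈ Finset.range (M + 1), (M : ℝ) * μ h := by
          refine Finset.sum_le_sum fun h hh => ?_
          rw [Finset.mem_range] at hh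
          have : (h : ℝ) ≤ M := by exact_mod_cast Nat.lt_succ_iff.mp hh
          exact mul_le_mul_of_nonneg_right this (hμ h)
      _ = M := by rw [← Finset.mul_sum, hμ1, mul_one]
  rcases hT10.lt_or_eq with hT1p | hT1z
  · rcases hT20.lt_or_eq with hT2p | hT2z
    · -- both factors non-degenerate
      exact gateConv_rows_heavy_of_freeThmA hy hy1 hq0 hq1 (fun M₁ M₂ ν₁ ν₂ τ₁ τ₂ => hF y M₁ M₂ ν₁ ν₂ τ₁ τ₂ hy hy1)
        n1 z1 s1 rfl hT1p t1 n2 z2 s2 rfl hT2p t2 c1 c2 d hd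
    · -- `T₂ = 0`: `μ₂ = δ₀`, the convolution is `μ₁`
      have hδ := hn_eq_delta_of_mean_zero n2 s2 hT2z.symm
      rw [← hT2z, add_zero] at hd ⊢
      have hτM : q * T₁ ≤ (M₁ : ℝ) + 1 := by nlinarith [hmeanle M₁ μ₁ n1 s1]
      have key := hn_row_of_delta (M₁ := M₂) (M₂ := M₁) (μ₁ := μ₂) (μ₂ := μ₁) (q := q) (y := y) hδ hd hτM (c1 d hd)
      rw [hnr_lconv_comm M₁ M₂ μ₁ μ₂, Nat.add_comm M₁ M₂]
      exact key
  · -- `T₁ = 0`: `μ₁ = δ₀`, the convolution is `μ₂`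
    have hδ := hn_eq_delta_of_mean_zero n1 s1 hT1z.symm
    rw [← hT1z, zero_add] at hd ⊢
    have hτM : q * T₂ ≤ (M₂ : ℝ) + 1 := by nlinarith [hmeanle M₂ μ₂ n2 s2]
    exact hn_row_of_delta hδ hd hτM (c2 d hd)

end LawDec

end Quant

end Summit.CriticalPhenomena.PercolationContinuityZ3.Theorems
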